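import Mathlib
import Summits.Ventures.PercRepro2.UniversalAlignedDefs
import Summits.Ventures.PercRepro2.UniversalTransport

/-! # The level-aligned package transports along label-preserving order isomorphisms
(seat mine-b, cell pub-perc-repro2; MINE-B.md §29)

`PackageL.transport`: a package on `(X, r, b)` and an order isomorphism `e : X ≃o X'` with `r' (e x) = r x`,
`b' (e x) = b x` give a package on `(X', r', b')` — the assignment and the level relays are conjugated by
`e`.  This is `universal_transport` (UniversalTransport.lean) extended to the whole package; it carries the
package from the cell's abstract SP cubes (`SP.Conf`) to the configuration posets of series–parallel
PATTERNS at graph level (`Conf Y` with the flow labels `rLabP` / `bLabP`), UniversalAlignedPattern.lean. -/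

namespace Summit.Ventures.PercRepro2.UHClosure

open Finset

variable {X X' : Type*} [Preorder X] [Preorder X'] [Fintype X] [Fintype X']
variable (e : X ≃o X') {r b : X → ℕ} {r' b' : X' → ℕ}

section slots

variable (hr : ∀ x, r' (e x) = r x) (hb : ∀ x, b' (e x) = b x)

omit [Fintype X] [Fintype X'] in
include hr in
/-- the red label of `X'` through `e.symm` -/
lemma tr_red (x' : X') : r' x' = r (e.symm x') := by rw [← hr (e.symm x'), e.apply_symm_apply]

omit [Fintype X] [Fintype X'] in
include hb in
/-- the blue label of `X'` through `e.symm` -/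
lemma tr_blue (x' : X') : b' x' = b (e.symm x') := by rw [← hb (e.symm x'), e.apply_symm_apply]

omit [Fintype X] in
include hr hb in
/-- the source behind a slot of `X'` is a source of `X` -/
lemma tr_src (q : SlotL (USrc r' b') b') : USrc r b (e.symm q.1.1.1) :=
  ⟨by rw [← tr_red e hr]; exact q.1.1.2.1.1, by rw [← tr_blue e hb]; exact q.1.1.2.1.2⟩

omit [Fintype X] in
include hb in
/-- the index of a slot of `X'` is below the blue label of the source behind it -/
lemma tr_lt (q : SlotL (USrc r' b') b') : q.1.2.val < b (e.symm q.1.1.1) := by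
  rw [← tr_blue e hb]; exact q.2

include hr hb in
/-- the slot of `X` behind a slot of `X'` -/
def trSlotL (q : SlotL (USrc r' b') b') : SlotL (USrc r b) b :=
  ⟨⟨⟨e.symm q.1.1.1, tr_src e hr hb q, (tr_src e hr hb q).2⟩,
    ⟨q.1.2.val, lt_of_lt_of_le (tr_lt e hb q) (le_of_lt (lt_boundL b (e.symm q.1.1.1)))⟩⟩, tr_lt e hb q⟩

/-- the source of `trSlotL` -/
@[simp] lemma trSlotL_src (q : SlotL (USrc r' b') b') : (trSlotL e hr hb q).1.1.1 = e.symm q.1.1.1 := rfl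

/-- the index of `trSlotL` -/
@[simp] lemma trSlotL_idx (q : SlotL (USrc r' b') b') : (trSlotL e hr hb q).1.2.val = q.1.2.val := rfl

/-- `trSlotL` is injective -/
lemma trSlotL_inj {q q' : SlotL (USrc r' b') b'} (h : trSlotL e hr hb q = trSlotL e hr hb q') : q = q' := by
  have hx : e.symm q.1.1.1 = e.symm q'.1.1.1 := congrArg (fun s : SlotL (USrc r b) b => s.1.1.1) h
  have hi : q.1.2.val = q'.1.2.val := congrArg (fun s : SlotL (USrc r b) b => s.1.2.val) h
  exact slotL_ext q q' (e.symm.injective hx) hi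

end slots

/-- **the level-aligned package transports along a label-preserving order isomorphism** -/
def PackageL.transport (hr : ∀ x, r' (e x) = r x) (hb : ∀ x, b' (e x) = b x) (P : PackageL r b) :
    PackageL r' b' where
  f := fun q => e (P.f (trSlotL e hr hb q))
  f_inj := by
    intro q q' h
    exact trSlotL_inj e hr hb (P.f_inj (e.injective h))
  f_spec := by
    intro q
    obtain ⟨hle, hred, hblue⟩ := P.f_spec (trSlotL e hr hb q)
    rw [trSlotL_src] at hle hblue
    refine ⟨?_, ?_, ?_⟩
    · have : e (P.f (trSlotL e hr hb q)) ≤ e (e.symm q.1.1.1) := e.le_iff_le.2 hle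
      rwa [e.apply_symm_apply] at this
    · rw [hr]; exact hred
    · rw [hb, tr_blue e hb]; exact hblue
  α := fun k x' => e (P.α k (e.symm x'))
  α_inj := by
    intro k z z' hz hz' h
    rw [tr_blue e hb] at hz hz'
    exact e.symm.injective (P.α_inj k _ _ hz hz' (e.injective h))
  α_spec := by
    intro k z hz
    rw [tr_blue e hb] at hz
    obtain ⟨hle, hred, hblue⟩ := P.α_spec k _ hz
    refine ⟨?_, ?_, ?_⟩
    · have : e (P.α k (e.symm z)) ≤ e (e.symm z) := e.le_iff_le.2 hle
      rwa [e.apply_symm_apply] at this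
    · rw [hr]; exact hred
    · rw [hb, tr_blue e hb]; exact hblue
  α_avoid := by
    intro k z hz p hp h
    rw [tr_blue e hb] at hz
    exact P.α_avoid k _ hz (trSlotL e hr hb p) (by rw [trSlotL_idx]; exact hp) (e.injective h)
  α_src := by
    intro p hp
    have e1 : P.α 0 (e.symm p.1.1.1) = P.f (trSlotL e hr hb p) :=
      P.α_src (trSlotL e hr hb p) (by rw [trSlotL_idx]; exact hp)
    show e (P.α 0 (e.symm p.1.1.1)) = e (P.f (trSlotL e hr hb p))
    rw [e1]
  β := fun k x' => e (P.β k (e.symm x'))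
  β_inj := by
    intro k u u' hu hz hu' hz' h
    rw [tr_red e hr] at hu hu'
    rw [tr_blue e hb] at hz hz'
    exact e.symm.injective (P.β_inj k _ _ hu hz hu' hz' (e.injective h))
  β_spec := by
    intro k u hu hz
    rw [tr_red e hr] at hu
    rw [tr_blue e hb] at hz
    obtain ⟨hle, hred, hblue⟩ := P.β_spec k _ hu hz
    refine ⟨?_, ?_, ?_⟩
    · have : e (P.β k (e.symm u)) ≤ e (e.symm u) := e.le_iff_le.2 hle
      rwa [e.apply_symm_apply] at this
    · rw [hr]; exact hred
    · rw [hb, tr_blue e hb]; exact hblue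
  β_avoid := by
    intro k u hu hz p hp h
    rw [tr_red e hr] at hu
    rw [tr_blue e hb] at hz
    exact P.β_avoid k _ hu hz (trSlotL e hr hb p) (by rw [trSlotL_idx]; exact hp) (e.injective h)

end Summit.Ventures.PercRepro2.UHClosure
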